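import Summits.AtomisticToContinuum.Crystallization.Theorems.PerronTransitivityUniformBindingRigidityCohesionC

/-!
# Cohesion of uniformly bound Lennard-Jones configurations, X: compactness of bound half-spaces

Helper file (`--supports stmt-AtomisticToContinuum-15099`) of the stub
`stub_noThickHalfSpaceBinding` (= `(NHB-thick)`) of the line `registered` of the crux
`Summit.AtomisticToContinuum.Crystallization.Theses.PerronTransitivity.UniformBindingRigidity`
(item stmt-AtomisticToContinuum-15099).  The first step of every extremal-counterexample (normal
form) argument on the open core: the class

  `𝒞(δ, B)` of pairs `(Y, u)`, `Y ⊆ ℝ³` `δ`-separated, `0 ∈ Y ⊆ {⟪·, u⟫ ≤ 0}`, `‖u‖ = 1`, all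
  Lennard-Jones site sums of `Y` at most `B`,

is SEQUENTIALLY COMPACT in the local matching topology (with convergence of the directions):

* §18 `halfSpaceBound_of_ballMatch_limit` — closedness: if `(Yₙ, uₙ) ∈ 𝒞(δ, B)`, `Yₙ → Y`
  locally (`BallMatch ε R 0 Yₙ Y` eventually, for all `R` and `ε > 0`), `Y` is `δ`-separated and
  `uₙ → u`, then `(Y, u) ∈ 𝒞(δ, B)` (`0 ∈ Y` since the points of `Y` near `0` form a finite set
  approached by `0 ∈ Yₙ`; `⟪q, u⟫ ≤ 0` since `q ∈ Y` is matched by points `a ∈ Yₙ` with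
  `⟪a, uₙ⟫ ≤ 0`, `a → q`, `uₙ → u`; the site bound by part III,
  `tsum_site_le_of_forall_exists_ballMatch`);
* §19 `exists_subseq_limit_halfSpaceBound` — compactness: every sequence in `𝒞(δ, B)` has a
  subsequence converging locally, with converging directions, to a member of `𝒞(δ, B)` (tree:
  `exists_subseq_forall_eventually_ballMatch` and compactness of the unit sphere).

Thickness (`∀ t, ∃ q ∈ Y, ⟪q, u⟫ < −t`) is NOT preserved under local limits (the deep part may
recede), so normal forms live in `𝒞(δ, B)`, whose thin members are excluded by the tree's
`noSlabBinding` only at the level `B = 2e*`.  All `[folklore]`.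
-/

noncomputable section

namespace Summit.AtomisticToContinuum.Crystallization.Theorems.PerronTransitivityUniformBindingRigidity

open scoped BigOperators Topology
open Filter Set Metric
open Literature.MathematicalPhysics.StatisticalMechanics
open Summit.AtomisticToContinuum.Crystallization.Theorems.ChargedEnergyGapNegative (E3)

/-! ## §18 Closedness of the class of bound half-space configurations -/

section Closed

variable {δ B : ℝ} {Ys : ℕ → Set E3} {us : ℕ → E3} {Y : Set E3} {u : E3}

/-- A local limit of sets containing `0` contains `0` (separated limit: the points of `Y` within
`1` of `0` form a finite set, and `0 ∈ Yₙ` is matched at every tolerance). [folklore] -/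
theorem zero_mem_of_ballMatch_limit (hδ : 0 < δ)
    (hYsep : ∀ p ∈ Y, ∀ q ∈ Y, p ≠ q → δ ≤ dist p q) (h0n : ∀ n, (0 : E3) ∈ Ys n)
    (hlim : ∀ R ε : ℝ, 0 < ε → ∀ᶠ n in atTop, BallMatch ε R 0 (Ys n) Y) :
    (0 : E3) ∈ Y := by
  by_contra h0
  have hfin := finite_sep_ball hδ hYsep (0 : E3) 1
  obtain ⟨η, hη, hη1, hηY⟩ : ∃ η : ℝ, 0 < η ∧ η ≤ 1 ∧ ∀ q ∈ Y, dist q 0 ≤ 1 → η ≤ dist q 0 := by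
    by_cases hemp : hfin.toFinset.Nonempty
    · obtain ⟨q₀, hq₀, hminq⟩ := hfin.toFinset.exists_min_image (fun q => dist q 0) hemp
      rw [Set.Finite.mem_toFinset] at hq₀
      have hq₀0 : 0 < dist q₀ 0 := dist_pos.2 fun h => h0 (h ▸ hq₀.1)
      refine ⟨min (dist q₀ 0) 1, lt_min hq₀0 one_pos, min_le_right _ _, fun q hq hq1 => ?_⟩
      exact (min_le_left _ _).trans (hminq q (by rw [Set.Finite.mem_toFinset]; exact ⟨hq, hq1⟩))
    · refine ⟨1, one_pos, le_rfl, fun q hq hq1 => ?_⟩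
      exact absurd ⟨q, by rw [Set.Finite.mem_toFinset]; exact ⟨hq, hq1⟩⟩ hemp
  obtain ⟨n, hn⟩ := (hlim 1 (η / 2) (by positivity)).exists
  obtain ⟨s, hs, hs0⟩ := hn.2 0 (h0n n) (by simp)
  rw [dist_comm] at hs0
  have hs1 : dist s 0 ≤ 1 := by linarith
  have := hηY s hs hs1
  linarith

/-- A local limit of configurations lying in the half-spaces `{⟪·, uₙ⟫ ≤ 0}`, `uₙ → u`, lies in
`{⟪·, u⟫ ≤ 0}`. [folklore] -/
theorem inner_le_zero_of_ballMatch_limit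
    (hhalfn : ∀ n, ∀ q ∈ Ys n, inner ℝ q (us n) ≤ 0) (hun : ∀ n, ‖us n‖ = 1)
    (hlim : ∀ R ε : ℝ, 0 < ε → ∀ᶠ n in atTop, BallMatch ε R 0 (Ys n) Y)
    (hu : Tendsto us atTop (𝓝 u)) :
    ∀ q ∈ Y, inner ℝ q u ≤ 0 := by
  intro q hq
  refine le_of_forall_pos_le_add fun η hη => ?_
  rw [zero_add]
  -- tolerances: matching within `η/2`, direction within `η / (2(‖q‖ + 1))`
  set ε' : ℝ := η / (2 * (‖q‖ + 1)) with hε'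
  have hq1 : 0 < ‖q‖ + 1 := by positivity
  have hε'0 : 0 < ε' := by positivity
  have h1 := hlim ‖q‖ (η / 2) (by positivity)
  have h2 : ∀ᶠ n in atTop, dist (us n) u < ε' := Metric.tendsto_nhds.1 hu ε' hε'0
  obtain ⟨n, hBM, hdir⟩ := (h1.and h2).exists
  obtain ⟨a, ha, haq⟩ := hBM.1 q hq (by rw [dist_zero_right])
  -- `⟪q, u⟫ = ⟪a, uₙ⟫ + ⟪q − a, uₙ⟫ + ⟪q, u − uₙ⟫`
  have e1 : inner ℝ q u = inner ℝ a (us n) + inner ℝ (q - a) (us n) + inner ℝ q (u - us n) := by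
    rw [inner_sub_left, inner_sub_right]; ring
  have b1 : |inner ℝ (q - a) (us n)| ≤ η / 2 := by
    refine (abs_real_inner_le_norm _ _).trans ?_
    rw [hun, mul_one, ← dist_eq_norm, dist_comm]
    exact haq
  have b2 : |inner ℝ q (u - us n)| ≤ η / 2 := by
    refine (abs_real_inner_le_norm _ _).trans ?_
    have hd : ‖u - us n‖ ≤ ε' := by rw [← dist_eq_norm, dist_comm]; exact hdir.le
    calc ‖q‖ * ‖u - us n‖ ≤ ‖q‖ * ε' := mul_le_mul_of_nonneg_left hd (norm_nonneg _)
      _ ≤ η / 2 := by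
        rw [hε', mul_div_assoc']
        rw [div_le_div_iff₀ (by positivity) (by norm_num)]
        nlinarith [norm_nonneg q]
  have := hhalfn n a ha
  have := le_abs_self (inner ℝ (q - a) (us n))
  have := le_abs_self (inner ℝ q (u - us n))
  linarith

/-- **Closedness of `𝒞(δ, B)`.** If `δ`-separated `Yₙ ∋ 0`, `Yₙ ⊆ {⟪·, uₙ⟫ ≤ 0}` (`‖uₙ‖ = 1`),
with all Lennard-Jones site sums `≤ B`, converge locally to a `δ`-separated `Y` and `uₙ → u`, then
`0 ∈ Y`, `‖u‖ = 1`, `Y ⊆ {⟪·, u⟫ ≤ 0}` and all site sums of `Y` are `≤ B`. [folklore] -/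
theorem halfSpaceBound_of_ballMatch_limit (hδ : 0 < δ)
    (hsepn : ∀ n, ∀ p ∈ Ys n, ∀ q ∈ Ys n, p ≠ q → δ ≤ dist p q)
    (h0n : ∀ n, (0 : E3) ∈ Ys n)
    (hhalfn : ∀ n, ∀ q ∈ Ys n, inner ℝ q (us n) ≤ 0) (hun : ∀ n, ‖us n‖ = 1)
    (hbdn : ∀ n, ∀ p ∈ Ys n,
      ∑' q : {q : E3 // q ∈ Ys n ∧ q ≠ p}, lennardJones (dist p q.1) ≤ B)
    (hYsep : ∀ p ∈ Y, ∀ q ∈ Y, p ≠ q → δ ≤ dist p q)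
    (hlim : ∀ R ε : ℝ, 0 < ε → ∀ᶠ n in atTop, BallMatch ε R 0 (Ys n) Y)
    (hu : Tendsto us atTop (𝓝 u)) :
    (0 : E3) ∈ Y ∧ ‖u‖ = 1 ∧ (∀ q ∈ Y, inner ℝ q u ≤ 0) ∧
      ∀ p ∈ Y, ∑' q : {q : E3 // q ∈ Y ∧ q ≠ p}, lennardJones (dist p q.1) ≤ B := by
  refine ⟨zero_mem_of_ballMatch_limit hδ hYsep h0n hlim, ?_,
    inner_le_zero_of_ballMatch_limit hhalfn hun hlim hu, fun p hp => ?_⟩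
  · have h := (continuous_norm.tendsto u).comp hu
    have h' : Tendsto (fun n => ‖us n‖) atTop (𝓝 1) := by
      simp only [hun]; exact tendsto_const_nhds
    exact tendsto_nhds_unique h' h ▸ rfl
  · refine tsum_site_le_of_forall_exists_ballMatch hδ hYsep (fun R ε hε => ?_) hp
    obtain ⟨n, hn⟩ := (hlim R ε hε).exists
    exact ⟨Ys n, hsepn n, hbdn n, hn⟩

end Closed

/-! ## §19 Sequential compactness of the class of bound half-space configurations -/

/-- **Sequential compactness of `𝒞(δ, B)`.** Every sequence `(Yₙ, uₙ)` of `δ`-separated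
(`δ > 0`) configurations `Yₙ ∋ 0`, `Yₙ ⊆ {⟪·, uₙ⟫ ≤ 0}`, `‖uₙ‖ = 1`, with all Lennard-Jones site
sums `≤ B`, has a subsequence converging locally (`BallMatch` on every ball about `0`, at every
tolerance, eventually) and in direction to some `(Y, u)` of the same class. [folklore] -/
theorem exists_subseq_limit_halfSpaceBound {δ B : ℝ} (hδ : 0 < δ)
    (Ys : ℕ → Set (EuclideanSpace ℝ (Fin 3))) (us : ℕ → EuclideanSpace ℝ (Fin 3))
    (hsepn : ∀ n, ∀ p ∈ Ys n, ∀ q ∈ Ys n, p ≠ q → δ ≤ dist p q)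
    (h0n : ∀ n, (0 : EuclideanSpace ℝ (Fin 3)) ∈ Ys n)
    (hhalfn : ∀ n, ∀ q ∈ Ys n, inner ℝ q (us n) ≤ 0) (hun : ∀ n, ‖us n‖ = 1)
    (hbdn : ∀ n, ∀ p ∈ Ys n,
      ∑' q : {q : EuclideanSpace ℝ (Fin 3) // q ∈ Ys n ∧ q ≠ p},
        lennardJones (dist p q.1) ≤ B) :
    ∃ (φ : ℕ → ℕ) (Y : Set (EuclideanSpace ℝ (Fin 3))) (u : EuclideanSpace ℝ (Fin 3)),
      StrictMono φ ∧
      (∀ p ∈ Y, ∀ q ∈ Y, p ≠ q → δ ≤ dist p q) ∧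
      (0 : EuclideanSpace ℝ (Fin 3)) ∈ Y ∧ ‖u‖ = 1 ∧ (∀ q ∈ Y, inner ℝ q u ≤ 0) ∧
      (∀ p ∈ Y, ∑' q : {q : EuclideanSpace ℝ (Fin 3) // q ∈ Y ∧ q ≠ p},
        lennardJones (dist p q.1) ≤ B) ∧
      (∀ R ε : ℝ, 0 < ε → ∀ᶠ k in atTop, BallMatch ε R 0 (Ys (φ k)) Y) ∧
      Tendsto (fun k => us (φ k)) atTop (𝓝 u) := by
  -- local limit of the sets, then a convergent subsequence of the directions
  obtain ⟨φ, Y, hφ, hYsep, hlim⟩ := exists_subseq_forall_eventually_ballMatch hδ Ys hsepn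
  obtain ⟨u, -, ψ, hψ, hlimu⟩ := (isCompact_sphere (0 : E3) 1).tendsto_subseq
    (x := fun n => us (φ n)) fun n => mem_sphere_zero_iff_norm.2 (hun (φ n))
  have hlim' : ∀ R ε : ℝ, 0 < ε → ∀ᶠ k in atTop, BallMatch ε R 0 (Ys (φ (ψ k))) Y :=
    fun R ε hε => hψ.tendsto_atTop.eventually (hlim R ε hε)
  have hcl := halfSpaceBound_of_ballMatch_limit (Ys := fun k => Ys (φ (ψ k)))
    (us := fun k => us (φ (ψ k))) hδ (fun k => hsepn _) (fun k => h0n _) (fun k => hhalfn _)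
    (fun k => hun _) (fun k => hbdn _) hYsep hlim' hlimu
  exact ⟨fun k => φ (ψ k), Y, u, hφ.comp hψ, hYsep, hcl.1, hcl.2.1, hcl.2.2.1, hcl.2.2.2,
    hlim', hlimu⟩

/-! ## Registered sub-goal of `stub_noThickHalfSpaceBinding`: compactness of the class -/

/-- **Sub-goal `stub_nhb_limitClosed` of the stub `stub_noThickHalfSpaceBinding`** (registered on
stmt-AtomisticToContinuum-15099): sequential compactness of the class of `δ`-separated, uniformly
`B`-bound half-space configurations through `0` in the local matching topology
(`exists_subseq_limit_halfSpaceBound` in arrow form). [folklore] -/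
theorem stub_nhb_limitClosed :
    ∀ (δ B : ℝ), 0 < δ →
      ∀ (Ys : ℕ → Set (EuclideanSpace ℝ (Fin 3))) (us : ℕ → EuclideanSpace ℝ (Fin 3)),
      (∀ n, ∀ p ∈ Ys n, ∀ q ∈ Ys n, p ≠ q → δ ≤ dist p q) →
      (∀ n, (0 : EuclideanSpace ℝ (Fin 3)) ∈ Ys n) →
      (∀ n, ∀ q ∈ Ys n, inner ℝ q (us n) ≤ 0) → (∀ n, ‖us n‖ = 1) →
      (∀ n, ∀ p ∈ Ys n, ∑' q : {q : EuclideanSpace ℝ (Fin 3) // q ∈ Ys n ∧ q ≠ p},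
        lennardJones (dist p q.1) ≤ B) →
      ∃ (φ : ℕ → ℕ) (Y : Set (EuclideanSpace ℝ (Fin 3))) (u : EuclideanSpace ℝ (Fin 3)),
        StrictMono φ ∧
        (∀ p ∈ Y, ∀ q ∈ Y, p ≠ q → δ ≤ dist p q) ∧
        (0 : EuclideanSpace ℝ (Fin 3)) ∈ Y ∧ ‖u‖ = 1 ∧ (∀ q ∈ Y, inner ℝ q u ≤ 0) ∧
        (∀ p ∈ Y, ∑' q : {q : EuclideanSpace ℝ (Fin 3) // q ∈ Y ∧ q ≠ p},
          lennardJones (dist p q.1) ≤ B) ∧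
        (∀ R ε : ℝ, 0 < ε → ∀ᶠ k in Filter.atTop, BallMatch ε R 0 (Ys (φ k)) Y) ∧
        Filter.Tendsto (fun k => us (φ k)) Filter.atTop (nhds u) :=
  fun _ _ hδ Ys us hsepn h0n hhalfn hun hbdn =>
    exists_subseq_limit_halfSpaceBound hδ Ys us hsepn h0n hhalfn hun hbdn

end Summit.AtomisticToContinuum.Crystallization.Theorems.PerronTransitivityUniformBindingRigidity

end
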